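import Summits.QuantumFields.YangMills.Theorems.BalabanUVNodesPortS1P0CFamilyRows
import Summits.QuantumFields.YangMills.Theorems.BalabanUVNodesP0CRealSliceTransfer

/-!
# NODE O port — `stub_P0C`'s supplier: THE HARDEST ROW (P4-lat) RE-SHAPED ON THE REAL SLICE
# (★★★ director-ym №640 (2)(d); ◇ lens-1 memo `nodeO-cover/LENS-1-NODE-v22-S3-KERNEL-SIDE-IS-P0C.md` v22.1 sha16 0e4b735a4d60565e §4 (N3), §9, §11;
# Lean piece ✓`Theorems/BalabanUVNodesP0CRealSliceTransfer.lean` BY NAME)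

Definer row `pub-ymgap-node00-def-Y` (g41), `--supports stmt-QuantumFields-27930 --as helper`; count-neutral.  [I] = [Balaban1987RG1], [II] = [Balaban1988RG2Cluster],
[B9] = [Balaban1985BackgroundPropagators], [16] = [Balaban1985UV3].

WHICH ROW.  Of ✓`P0FamilyRows`' twelve rows the XL one is (P4-lat) = ✓`P0CarrierLatticeDecay F δ₀ c₀ δ₁ Mc α₀ α₁ k TY`: the lattice-weighted Schur rows∕columns
`Σ_j ‖TY n Y φ i j‖·e^{δ₁·tdist_k(i,j)} ≤ c₀·e^{−δ₀·dj Y}` at EVERY COMPLEX pair `φ` with `encodeCfg φ ∈ recordUc(α₀,α₁) Y`.  Its declared source, [B9] Cor 3.8 (3.94) p.410 ∕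
Thm 3.12 p.419 with the lattice decay (3.42) p.399, is a REAL-background theorem; [B9] Thm 3.4 p.400 continues the operators holomorphically to the complex neighbourhood WITH A
BOUND but displays NO decay rate for the walk TERMS ([II] p.15 «α′₀, α′₁ much bigger than α₀, α₁»).  The two-constants theorem (✓`rowDecay_of_realSlice`, Nevanlinna) closes that
gap with an explicit loss `λ`, so the supplier's road for (P4-lat) becomes print's regime + function theory:

THE RE-SHAPED ROWS (all `def … : Prop`, DISPLAYED, asserted for nothing), over the same family binder `TY` as `P0CarrierLatticeDecay`:
* (R-real) `P4LatRealRows F 𝓡 δr c₀ δ₁ Mc α₀' α₁' k TY` — (P4-lat)'s two weighted clauses VERBATIM, but only at `φ` in the REAL LOCUS `𝓡 K` (a binder: which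
  configurations of the `(𝐔, 𝐉)`-space are real — `SU(2)`-valued `𝐔`, `𝔰𝔲(2)`-valued `𝐉`; the lane's shared pin R-28.2, instantiated by the supplier) of the OUTER record
  space `recordUc(α₀',α₁') Y`, at the REAL rate `δr`.  [B9] (3.42) p.399, Cor 3.8 (3.94) p.410, Thm 3.12 p.419; [16] (23) p.262 — print's regime.
* (R-M) `P4LatRateFree F M δ₁ Mc α₀' α₁' k TY` — the same two weighted sums `≤ M`, NO rate, at EVERY complex `φ` of `recordUc(α₀',α₁') Y`.  [B9] Thm 3.4 first sentence
  p.400 + its «small perturbations» proof (3.86) p.407, read piecewise; `M ∈ O(1)(d, L)` on print's word (Thm 3.10 p.416 «The constant O(1) depends on d and L only»).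
* (R-hol) `P4LatHol F Mc α₀' α₁' k TY` — (P4-d)'s shape (entrywise `AnalyticAt ℂ`) at the outer radii, for the family the decay is asked of.  [I] (1.16) p.263; [B9] Thm 3.4.
* (R-dom) `RecordChartsDominate F 𝓡 Mc k α₀ α₁ α₀' α₁' R₀ Ran` — THE RADII LEMMA as a RATIO statement: every `φ` of the INNER space `recordUc(α₀,α₁) Y` is `cfg w₀`,
  `‖w₀‖ < R₀`, for a chart `cfg : (Fin m → ℂ) → Sect2.CPair …` holomorphic on `ball 0 Ran` which maps that ball into the OUTER space `recordUc(α₀',α₁') Y` and its REAL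
  points (`realStructurePi`: coordinatewise real) into the real locus `𝓡`.  Print: `𝐔 = 𝐔′𝐔_ℝ`, `𝐔′ = exp(iηA)`, `A` complex ([B9] (3.35)–(3.37) p.397; [II] p.15).
* `realDemandRate δ₀ R₀ Ran := δ₀ ∕ (1 − λ)`, `λ := lam (R₀∕(Ran − R₀))` — the REAL rate to ask so that the complex rate DEMANDED is met (✓`demandTransfer`); at `Ran = 3R₀`:
  `λ = lam ½ = (2∕π)·arctan(4∕3) ≈ 0.5903`, `δr ≈ 2.44·δ₀` (bound side ✓`realRate_le`: `≤ δ₀∕(1 − 2∕π) ≈ 2.76·δ₀`).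
* ★ `P4LatOfRealSliceBridge … : Prop` — THE BRIDGE, displayed: `0 < R₀ → 2R₀ < Ran → 0 ≤ c₀ → c₀ ≤ M → 0 ≤ δ₀ → (R-hol) → (R-M) → (R-real at δr := realDemandRate δ₀ R₀ Ran) →
  (R-dom) → P0CarrierLatticeDecay F δ₀ M δ₁ Mc α₀ α₁ k TY` (constant `c₀^{1−λ}M^{λ} ≤ M`, rate `(1−λ)·δr = δ₀`).
* ★★ `p4LatOfRealSliceBridge_holds` — THE BRIDGE PROVED (function theory only): per row index `i`, ✓`rowDecay_of_realSlice (realStructurePi (Fin m))` applied to the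
  `ℓ¹`-valued holomorphic map `w ↦ (j ↦ TY n Y (cfg w) i j · e^{δ₁·tdist(i,j)})` (fixed positive column weights: holomorphy and the `PiLp 1` reading survive, NO `(#columns)^λ`
  loss — memo §4 D-2); columns likewise.

HOW IT SITS IN ✓`P0FamilySupply`'s (Q-ord) (the letter, ✓`P0FamilyRows` and the closer ✓`p0HolExtAtRecordGL_of_familySupply` are NOT edited — the re-shape is the SUPPLIER's
internal road, ADDITIVE): `∃ c₀ γ₀ γ₁ δ₁` ↦ the supplier offers `c₀' := M` (absolute, print's «O(1)(d, L) only»); `λ` is fixed by the RATIO (`α' := α₁(print)` absolute,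
`α := α'∕3`); `∀ δ₀ > 0, ∃ Mth` ↦ `Mth(δr)` of the REAL theorem at `δr := realDemandRate δ₀ R₀ Ran` (print's «M sufficiently large»; (3.94)'s per-step `O(M^{−½})`).  Both
downstream `δ₀`-demands are then met by the same `∀ δ₀`: GL's, and the N10 bridge's `AnimalRateRow δ₀` (`δ₀ > 64·log 162`, ✓`K0P0CarrierPins.animRate`) — the consumer
instantiates; the supplier never sees `C_anim`.

HONEST FRAMING.  Definitions + ONE function-theoretic theorem over landed letters (✓`rowDecay_of_realSlice`, ✓`demandTransfer`); NO estimate of Bałaban's is proved or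
ported; (R-real), (R-M), (R-hol), (R-dom) are inhabited NOWHERE (they are [B9] §3 ∕ [16] (23) content at the record + the undecided real locus R-28.2); (R-M) for the
(2.11)∕(3.57)-PIECES at complex background is read off Thm 3.4's PROOF, not a display of print; `P0FamilySupply F` inhabited nowhere; `stub_P0C` ∕ ⟨27930⟩ OPEN (1∕7, v3.8);
K0ᴬ ⟨27238⟩ 0∕2 · NODE O 0∕1 · COUNT 8∕28 · K 1∕4 UNMOVED; finite `𝕋⁴_{L^K}` at fixed ε — NOT continuum ∕ OS ∕ Clay; **the Yang–Mills mass gap is NOT proved by any of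
this.**  No `sorry`, no `instance`, no `notation`; standard axioms.
-/

noncomputable section

open scoped BigOperators Matrix.Norms.L2Operator Topology
open Metric Set

namespace Summit.QuantumFields.YangMills.Theorems.BalabanUVNodesPortS1

open Summit.QuantumFields.YangMills.Theorems.K0RecordFormatNames
open Literature.MathematicalPhysics.QuantumFieldTheory.Balaban1983to89
open Literature.MathematicalPhysics.QuantumFieldTheory.Balaban1983to89.Node00
open Literature.MathematicalPhysics.QuantumFieldTheory.Balaban1983to89.T4Continuum (T4Family)
open Literature.MathematicalPhysics.QuantumFieldTheory.Balaban1983to89.B13RealSliceEntryLetters (RealStructure realStructurePi lam lam_lt_one)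
open Summit.QuantumFields.YangMills.Theorems.BalabanUVNodesPortS1.Lens1P4RealSlice (rowDecay_of_realSlice demandTransfer)

variable (F : T4Family)

/-! ## §1  The re-shaped rows (displayed predicates WITH PARAMETERS — assert nothing) -/

/-- (R-real) **THE REAL-HISTORY ROWS**: (P4-lat)'s two lattice-weighted Schur clauses VERBATIM, asked only at configurations `φ` of the REAL LOCUS `𝓡 K` lying in the OUTER
record space `recordUc(α₀', α₁') Y`, at the real rate `δr`.  Print's regime. [cite: Balaban1985BackgroundPropagators, (3.42) p.399, Cor. 3.8 (3.94) p.410, Thm 3.12 p.419;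
Balaban1985UV3, (23) p.262] -/
def P4LatRealRows (𝓡 : (K : ℕ) → Set (Sect2.CPair (F.P K) (MatA 2))) (δr c₀ δ₁ : ℝ) (Mc : ℕ) (α₀' α₁' : ℝ) (k : ℕ)
    (TY : (n : ℕ) → (recordDomSys F Mc k (recordK₀ F Mc k + n)).Dom → Sect2.CPair (F.P (recordK₀ F Mc k + n)) (MatA 2) →
        FluctIdx F k (recordK₀ F Mc k + n) → FluctIdx F k (recordK₀ F Mc k + n) → ℂ) : Prop :=
  ∀ (n : ℕ) (Y : (recordDomSys F Mc k (recordK₀ F Mc k + n)).Dom) (φ : Sect2.CPair (F.P (recordK₀ F Mc k + n)) (MatA 2)),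
    φ ∈ 𝓡 (recordK₀ F Mc k + n) →
    encodeCfg F (recordK₀ F Mc k + n) φ ∈ recordUc F Mc k α₀' α₁' (recordK₀ F Mc k + n) Y →
      (∀ i : FluctIdx F k (recordK₀ F Mc k + n),
        ∑ j : FluctIdx F k (recordK₀ F Mc k + n),
            ‖TY n Y φ i j‖ * Real.exp (δ₁ * (Site.tdist i.1.src j.1.src : ℝ)) ≤
          c₀ * Real.exp (-(δr * (recordDomSys F Mc k (recordK₀ F Mc k + n)).dj Y))) ∧
      (∀ j : FluctIdx F k (recordK₀ F Mc k + n),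
        ∑ i : FluctIdx F k (recordK₀ F Mc k + n),
            ‖TY n Y φ i j‖ * Real.exp (δ₁ * (Site.tdist i.1.src j.1.src : ℝ)) ≤
          c₀ * Real.exp (-(δr * (recordDomSys F Mc k (recordK₀ F Mc k + n)).dj Y)))

/-- (R-M) **THE RATE-FREE COMPLEX BOUND**: the same two lattice-weighted sums `≤ M`, NO rate in `dj Y`, at EVERY complex `φ` of the OUTER record space
`recordUc(α₀', α₁') Y`. [cite: Balaban1985BackgroundPropagators, Thm 3.4 p.400, (3.86) p.407, Thm 3.10 p.416 («The constant O(1) depends on d and L only»)] -/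
def P4LatRateFree (M δ₁ : ℝ) (Mc : ℕ) (α₀' α₁' : ℝ) (k : ℕ)
    (TY : (n : ℕ) → (recordDomSys F Mc k (recordK₀ F Mc k + n)).Dom → Sect2.CPair (F.P (recordK₀ F Mc k + n)) (MatA 2) →
        FluctIdx F k (recordK₀ F Mc k + n) → FluctIdx F k (recordK₀ F Mc k + n) → ℂ) : Prop :=
  ∀ (n : ℕ) (Y : (recordDomSys F Mc k (recordK₀ F Mc k + n)).Dom) (φ : Sect2.CPair (F.P (recordK₀ F Mc k + n)) (MatA 2)),
    encodeCfg F (recordK₀ F Mc k + n) φ ∈ recordUc F Mc k α₀' α₁' (recordK₀ F Mc k + n) Y →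
      (∀ i : FluctIdx F k (recordK₀ F Mc k + n),
        ∑ j : FluctIdx F k (recordK₀ F Mc k + n), ‖TY n Y φ i j‖ * Real.exp (δ₁ * (Site.tdist i.1.src j.1.src : ℝ)) ≤ M) ∧
      (∀ j : FluctIdx F k (recordK₀ F Mc k + n),
        ∑ i : FluctIdx F k (recordK₀ F Mc k + n), ‖TY n Y φ i j‖ * Real.exp (δ₁ * (Site.tdist i.1.src j.1.src : ℝ)) ≤ M)

/-- (R-hol) **HOLOMORPHY ON THE OUTER RECORD SPACE**: (P4-d)'s shape (entrywise `AnalyticAt ℂ`) at the outer radii, for the family the decay is asked of.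
[cite: Balaban1987RG1, (1.16) p.263; Balaban1985BackgroundPropagators, Thm 3.4 p.400] -/
def P4LatHol (Mc : ℕ) (α₀' α₁' : ℝ) (k : ℕ)
    (TY : (n : ℕ) → (recordDomSys F Mc k (recordK₀ F Mc k + n)).Dom → Sect2.CPair (F.P (recordK₀ F Mc k + n)) (MatA 2) →
        FluctIdx F k (recordK₀ F Mc k + n) → FluctIdx F k (recordK₀ F Mc k + n) → ℂ) : Prop :=
  ∀ (n : ℕ) (Y : (recordDomSys F Mc k (recordK₀ F Mc k + n)).Dom) (φ : Sect2.CPair (F.P (recordK₀ F Mc k + n)) (MatA 2)),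
    encodeCfg F (recordK₀ F Mc k + n) φ ∈ recordUc F Mc k α₀' α₁' (recordK₀ F Mc k + n) Y →
      ∀ i j : FluctIdx F k (recordK₀ F Mc k + n),
        AnalyticAt ℂ (fun ψ : Sect2.CPair (F.P (recordK₀ F Mc k + n)) (MatA 2) => TY n Y ψ i j) φ

/-- (R-dom) **THE RADII LEMMA, AS A RATIO STATEMENT IN HOLOMORPHIC CHARTS WHOSE REAL COORDINATES ARE REAL HISTORIES**: every configuration `φ` of the INNER record space
`recordUc(α₀, α₁) Y` is `cfg w₀` with `‖w₀‖ < R₀` for some chart `cfg : (Fin m → ℂ) → Sect2.CPair …` holomorphic on `ball 0 Ran`, mapping that ball into the OUTER space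
`recordUc(α₀', α₁') Y` and its coordinatewise-real points into the real locus `𝓡`.  The real locus `𝓡` is a BINDER (pin R-28.2). [cite: Balaban1985BackgroundPropagators,
(3.35)–(3.37) p.397, Thm 3.4 p.400; Balaban1988RG2Cluster, p.15 («α′₀, α′₁ much bigger than α₀, α₁»)] -/
def RecordChartsDominate (𝓡 : (K : ℕ) → Set (Sect2.CPair (F.P K) (MatA 2))) (Mc k : ℕ) (α₀ α₁ α₀' α₁' R₀ Ran : ℝ) : Prop :=
  ∀ (n : ℕ) (Y : (recordDomSys F Mc k (recordK₀ F Mc k + n)).Dom) (φ : Sect2.CPair (F.P (recordK₀ F Mc k + n)) (MatA 2)),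
    encodeCfg F (recordK₀ F Mc k + n) φ ∈ recordUc F Mc k α₀ α₁ (recordK₀ F Mc k + n) Y →
      ∃ (m : ℕ) (cfg : (Fin m → ℂ) → Sect2.CPair (F.P (recordK₀ F Mc k + n)) (MatA 2)) (w₀ : Fin m → ℂ),
        ‖w₀‖ < R₀ ∧ cfg w₀ = φ ∧ DifferentiableOn ℂ cfg (ball (0 : Fin m → ℂ) Ran) ∧
        (∀ w ∈ ball (0 : Fin m → ℂ) Ran, encodeCfg F (recordK₀ F Mc k + n) (cfg w) ∈ recordUc F Mc k α₀' α₁' (recordK₀ F Mc k + n) Y) ∧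
        (∀ w ∈ ball (0 : Fin m → ℂ) Ran, w ∈ (realStructurePi (Fin m)).Ereal → cfg w ∈ 𝓡 (recordK₀ F Mc k + n))

/-- **THE REAL RATE TO ASK**: `δr := δ₀ ∕ (1 − λ)`, `λ := lam (R₀ ∕ (Ran − R₀))`, so that `(1 − λ)·δr = δ₀` (✓`demandTransfer`). [cite: Ransford1995, Thm. 4.3.7;
Balaban1988RG2Cluster, p.15] -/
def realDemandRate (δ₀ R₀ Ran : ℝ) : ℝ := δ₀ / (1 - lam (R₀ / (Ran - R₀)))

/-- `(1 − λ) · realDemandRate δ₀ R₀ Ran = δ₀`. [cite: Ransford1995, Thm. 4.3.7] -/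
theorem one_sub_lam_mul_realDemandRate (δ₀ R₀ Ran : ℝ) :
    (1 - lam (R₀ / (Ran - R₀))) * realDemandRate δ₀ R₀ Ran = δ₀ := demandTransfer _ _

/-- `0 ≤ δ₀ → 0 ≤ realDemandRate δ₀ R₀ Ran` (`λ < 1`). [cite: Ransford1995, Thm. 4.3.7] -/
theorem realDemandRate_nonneg {δ₀ : ℝ} (R₀ Ran : ℝ) (hδ₀ : 0 ≤ δ₀) : 0 ≤ realDemandRate δ₀ R₀ Ran :=
  div_nonneg hδ₀ (by linarith [lam_lt_one (R₀ / (Ran - R₀))])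

/-! ## §2  The bridge (displayed), and the bridge proved -/

/-- ★ **THE BRIDGE** «re-shaped rows ⟹ (P4-lat)», DISPLAYED: `(R-hol) → (R-M) → (R-real at δr := realDemandRate δ₀ R₀ Ran) → (R-dom) → P0CarrierLatticeDecay F δ₀ M δ₁ Mc α₀ α₁ k TY`
under `0 < R₀`, `2R₀ < Ran`, `0 ≤ c₀ ≤ M`, `0 ≤ δ₀`.  Proved below (`p4LatOfRealSliceBridge_holds`). [cite: Balaban1985BackgroundPropagators, Thm 3.4 p.400, Cor. 3.8 (3.94) p.410;
Ransford1995, Thm. 4.3.7] -/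
def P4LatOfRealSliceBridge (𝓡 : (K : ℕ) → Set (Sect2.CPair (F.P K) (MatA 2))) (δ₀ c₀ M δ₁ : ℝ) (Mc : ℕ) (α₀ α₁ α₀' α₁' R₀ Ran : ℝ) (k : ℕ)
    (TY : (n : ℕ) → (recordDomSys F Mc k (recordK₀ F Mc k + n)).Dom → Sect2.CPair (F.P (recordK₀ F Mc k + n)) (MatA 2) →
        FluctIdx F k (recordK₀ F Mc k + n) → FluctIdx F k (recordK₀ F Mc k + n) → ℂ) : Prop :=
  0 < R₀ → 2 * R₀ < Ran → 0 ≤ c₀ → c₀ ≤ M → 0 ≤ δ₀ →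
    P4LatHol F Mc α₀' α₁' k TY → P4LatRateFree F M δ₁ Mc α₀' α₁' k TY →
    P4LatRealRows F 𝓡 (realDemandRate δ₀ R₀ Ran) c₀ δ₁ Mc α₀' α₁' k TY →
    RecordChartsDominate F 𝓡 Mc k α₀ α₁ α₀' α₁' R₀ Ran →
      P0CarrierLatticeDecay F δ₀ M δ₁ Mc α₀ α₁ k TY

/-- Interpolation bookkeeping: `c₀^{1−λ}·M^{λ} ≤ M` for `0 ≤ c₀ ≤ M`, `λ ≤ 1` (real powers, Mathlib's `0 ^ 0 = 1` convention included). [folklore] -/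
theorem rpow_interp_le {c₀ M l : ℝ} (hc₀ : 0 ≤ c₀) (hcM : c₀ ≤ M) (hl1 : l ≤ 1) :
    c₀ ^ (1 - l) * M ^ l ≤ M := by
  have hM : 0 ≤ M := hc₀.trans hcM
  calc c₀ ^ (1 - l) * M ^ l ≤ M ^ (1 - l) * M ^ l :=
        mul_le_mul_of_nonneg_right (Real.rpow_le_rpow hc₀ hcM (sub_nonneg.2 hl1)) (Real.rpow_nonneg hM l)
    _ = M ^ ((1 - l) + l) := (Real.rpow_add' hM (by norm_num)).symm
    _ = M := by simp

/-- ★★ **THE BRIDGE PROVED** — function theory only: per row (resp. column) index, ✓`rowDecay_of_realSlice` over the coordinate chart `Fin m → ℂ` with its real structure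
`realStructurePi`, applied to the `ℓ¹`-valued holomorphic map `w ↦ (j ↦ TY n Y (cfg w) i j · e^{δ₁·tdist(i,j)})`; the constant `c₀^{1−λ}M^{λ} ≤ M` (`rpow_interp_le`), the rate
`(1−λ)·δr = δ₀` (`one_sub_lam_mul_realDemandRate`).  NO estimate of Bałaban's is proved here — the four rows are hypotheses. [cite: Balaban1985BackgroundPropagators, Thm 3.4
p.400, Cor. 3.8 (3.94) p.410; Ransford1995, Thm. 4.3.7] -/
theorem p4LatOfRealSliceBridge_holds (𝓡 : (K : ℕ) → Set (Sect2.CPair (F.P K) (MatA 2))) (δ₀ c₀ M δ₁ : ℝ) (Mc : ℕ)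
    (α₀ α₁ α₀' α₁' R₀ Ran : ℝ) (k : ℕ)
    (TY : (n : ℕ) → (recordDomSys F Mc k (recordK₀ F Mc k + n)).Dom → Sect2.CPair (F.P (recordK₀ F Mc k + n)) (MatA 2) →
        FluctIdx F k (recordK₀ F Mc k + n) → FluctIdx F k (recordK₀ F Mc k + n) → ℂ) :
    P4LatOfRealSliceBridge F 𝓡 δ₀ c₀ M δ₁ Mc α₀ α₁ α₀' α₁' R₀ Ran k TY := by
  intro hR₀ h2 hc₀ hcM hδ₀ hHol hM hReal hDom n Y φ hφ
  obtain ⟨m, cfg, w₀, hw₀, hcfgw₀, hcfg, hout, hreal⟩ := hDom n Y φ hφ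
  have hd : 0 ≤ (recordDomSys F Mc k (recordK₀ F Mc k + n)).dj Y := (recordDomSys F Mc k (recordK₀ F Mc k + n)).dj_nonneg Y
  have hδr0 : 0 ≤ realDemandRate δ₀ R₀ Ran := realDemandRate_nonneg R₀ Ran hδ₀
  have hl1 : lam (R₀ / (Ran - R₀)) ≤ 1 := (lam_lt_one _).le
  have hconst : c₀ ^ (1 - lam (R₀ / (Ran - R₀))) * M ^ lam (R₀ / (Ran - R₀)) ≤ M := rpow_interp_le hc₀ hcM hl1
  have hrate : (1 - lam (R₀ / (Ran - R₀))) * realDemandRate δ₀ R₀ Ran * (recordDomSys F Mc k (recordK₀ F Mc k + n)).dj Y =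
      δ₀ * (recordDomSys F Mc k (recordK₀ F Mc k + n)).dj Y := by
    rw [one_sub_lam_mul_realDemandRate]
  have hw₀b : w₀ ∈ ball (0 : Fin m → ℂ) R₀ := mem_ball_zero_iff.2 hw₀
  -- the lattice weight (a positive real number per pair of indices)
  set wt : FluctIdx F k (recordK₀ F Mc k + n) → FluctIdx F k (recordK₀ F Mc k + n) → ℝ :=
    fun i j => Real.exp (δ₁ * (Site.tdist i.1.src j.1.src : ℝ)) with hwt
  have hwt_pos : ∀ i j, 0 < wt i j := fun i j => Real.exp_pos _
  -- entrywise holomorphy of `w ↦ TY n Y (cfg w) i j · wt i j` on the outer ball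
  have hcoord : ∀ i j, DifferentiableOn ℂ (fun w => TY n Y (cfg w) i j * (wt i j : ℂ)) (ball (0 : Fin m → ℂ) Ran) := by
    intro i j w hw
    exact (((hHol n Y (cfg w) (hout w hw) i j).differentiableAt).comp_differentiableWithinAt w (hcfg w hw)).mul_const _
  refine ⟨fun i => ?_, fun j => ?_⟩
  · -- ROWS: the ℓ¹-valued map of the `i`-th weighted row
    let g : (Fin m → ℂ) → PiLp 1 (fun _ : FluctIdx F k (recordK₀ F Mc k + n) => ℂ) :=
      fun w => (PiLp.continuousLinearEquiv 1 ℂ (fun _ : FluctIdx F k (recordK₀ F Mc k + n) => ℂ)).symm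
        (fun j => TY n Y (cfg w) i j * (wt i j : ℂ))
    have hnorm : ∀ w j, ‖g w j‖ = ‖TY n Y (cfg w) i j‖ * wt i j := by
      intro w j
      simp [g, Complex.norm_real, Real.norm_eq_abs, abs_of_pos (hwt_pos i j)]
    have hg : DifferentiableOn ℂ g (ball (0 : Fin m → ℂ) Ran) :=
      (ContinuousLinearEquiv.comp_differentiableOn_iff _).2 (differentiableOn_pi.2 fun j => hcoord i j)
    have hMg : ∀ u ∈ ball (0 : Fin m → ℂ) Ran, ∑ j, ‖g u j‖ ≤ M := fun u hu => by
      simp_rw [hnorm]; exact (hM n Y (cfg u) (hout u hu)).1 i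
    have hrealg : ∀ v ∈ (realStructurePi (Fin m)).Ereal, ‖v‖ < Ran →
        ∑ j, ‖g v j‖ ≤ c₀ * Real.exp (-(realDemandRate δ₀ R₀ Ran * (recordDomSys F Mc k (recordK₀ F Mc k + n)).dj Y)) := by
      intro v hv hvR
      have hvb : v ∈ ball (0 : Fin m → ℂ) Ran := mem_ball_zero_iff.2 hvR
      simp_rw [hnorm]; exact (hReal n Y (cfg v) (hreal v hvb hv) (hout v hvb)).1 i
    have key := rowDecay_of_realSlice (realStructurePi (Fin m)) hR₀ h2 hg hMg hrealg hc₀ hcM hδr0 hd w₀ hw₀b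
    simp_rw [hnorm, hcfgw₀] at key
    calc ∑ j, ‖TY n Y φ i j‖ * Real.exp (δ₁ * (Site.tdist i.1.src j.1.src : ℝ))
        ≤ c₀ ^ (1 - lam (R₀ / (Ran - R₀))) * M ^ lam (R₀ / (Ran - R₀)) *
            Real.exp (-((1 - lam (R₀ / (Ran - R₀))) * realDemandRate δ₀ R₀ Ran *
              (recordDomSys F Mc k (recordK₀ F Mc k + n)).dj Y)) := key
      _ ≤ M * Real.exp (-(δ₀ * (recordDomSys F Mc k (recordK₀ F Mc k + n)).dj Y)) := by
          rw [hrate]; exact mul_le_mul_of_nonneg_right hconst (Real.exp_pos _).le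
  · -- COLUMNS: the ℓ¹-valued map of the `j`-th weighted column
    let g : (Fin m → ℂ) → PiLp 1 (fun _ : FluctIdx F k (recordK₀ F Mc k + n) => ℂ) :=
      fun w => (PiLp.continuousLinearEquiv 1 ℂ (fun _ : FluctIdx F k (recordK₀ F Mc k + n) => ℂ)).symm
        (fun i => TY n Y (cfg w) i j * (wt i j : ℂ))
    have hnorm : ∀ w i, ‖g w i‖ = ‖TY n Y (cfg w) i j‖ * wt i j := by
      intro w i
      simp [g, Complex.norm_real, Real.norm_eq_abs, abs_of_pos (hwt_pos i j)]
    have hg : DifferentiableOn ℂ g (ball (0 : Fin m → ℂ) Ran) :=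
      (ContinuousLinearEquiv.comp_differentiableOn_iff _).2 (differentiableOn_pi.2 fun i => hcoord i j)
    have hMg : ∀ u ∈ ball (0 : Fin m → ℂ) Ran, ∑ i, ‖g u i‖ ≤ M := fun u hu => by
      simp_rw [hnorm]; exact (hM n Y (cfg u) (hout u hu)).2 j
    have hrealg : ∀ v ∈ (realStructurePi (Fin m)).Ereal, ‖v‖ < Ran →
        ∑ i, ‖g v i‖ ≤ c₀ * Real.exp (-(realDemandRate δ₀ R₀ Ran * (recordDomSys F Mc k (recordK₀ F Mc k + n)).dj Y)) := by
      intro v hv hvR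
      have hvb : v ∈ ball (0 : Fin m → ℂ) Ran := mem_ball_zero_iff.2 hvR
      simp_rw [hnorm]; exact (hReal n Y (cfg v) (hreal v hvb hv) (hout v hvb)).2 j
    have key := rowDecay_of_realSlice (realStructurePi (Fin m)) hR₀ h2 hg hMg hrealg hc₀ hcM hδr0 hd w₀ hw₀b
    simp_rw [hnorm, hcfgw₀] at key
    calc ∑ i, ‖TY n Y φ i j‖ * Real.exp (δ₁ * (Site.tdist i.1.src j.1.src : ℝ))
        ≤ c₀ ^ (1 - lam (R₀ / (Ran - R₀))) * M ^ lam (R₀ / (Ran - R₀)) *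
            Real.exp (-((1 - lam (R₀ / (Ran - R₀))) * realDemandRate δ₀ R₀ Ran *
              (recordDomSys F Mc k (recordK₀ F Mc k + n)).dj Y)) := key
      _ ≤ M * Real.exp (-(δ₀ * (recordDomSys F Mc k (recordK₀ F Mc k + n)).dj Y)) := by
          rw [hrate]; exact mul_le_mul_of_nonneg_right hconst (Real.exp_pos _).le

/-- ★ **THE SUPPLIER's USE**: the re-shaped rows give (P4-lat) with the constant `M` — apply to the Möbius pieces `fun n => p0cPiece F Mc k (K₀+n) (T n)` of a family `T` to get
`P0FamilyRows`' row (P4-lat). [cite: Balaban1985BackgroundPropagators, Cor. 3.8 (3.94) p.410; Balaban1987RG1, (2.11) p.267] -/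
theorem p0CarrierLatticeDecay_of_realSliceRows {𝓡 : (K : ℕ) → Set (Sect2.CPair (F.P K) (MatA 2))} {δ₀ c₀ M δ₁ : ℝ} {Mc : ℕ}
    {α₀ α₁ α₀' α₁' R₀ Ran : ℝ} {k : ℕ}
    {TY : (n : ℕ) → (recordDomSys F Mc k (recordK₀ F Mc k + n)).Dom → Sect2.CPair (F.P (recordK₀ F Mc k + n)) (MatA 2) →
        FluctIdx F k (recordK₀ F Mc k + n) → FluctIdx F k (recordK₀ F Mc k + n) → ℂ}
    (hR₀ : 0 < R₀) (h2 : 2 * R₀ < Ran) (hc₀ : 0 ≤ c₀) (hcM : c₀ ≤ M) (hδ₀ : 0 ≤ δ₀)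
    (hHol : P4LatHol F Mc α₀' α₁' k TY) (hM : P4LatRateFree F M δ₁ Mc α₀' α₁' k TY)
    (hReal : P4LatRealRows F 𝓡 (realDemandRate δ₀ R₀ Ran) c₀ δ₁ Mc α₀' α₁' k TY)
    (hDom : RecordChartsDominate F 𝓡 Mc k α₀ α₁ α₀' α₁' R₀ Ran) :
    P0CarrierLatticeDecay F δ₀ M δ₁ Mc α₀ α₁ k TY :=
  p4LatOfRealSliceBridge_holds F 𝓡 δ₀ c₀ M δ₁ Mc α₀ α₁ α₀' α₁' R₀ Ran k TY hR₀ h2 hc₀ hcM hδ₀ hHol hM hReal hDom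

end Summit.QuantumFields.YangMills.Theorems.BalabanUVNodesPortS1

end
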